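import Literature.RingTheory.KrullDimension.FibreInequality
import Mathlib.RingTheory.Jacobson.Ring
import Mathlib.RingTheory.Ideal.KrullsHeightTheorem
import Mathlib.RingTheory.KrullDimension.NonZeroDivisors
import Mathlib.LinearAlgebra.Dual.Lemmas
import HarnessLib

/-!
# Generic avoidance: a family of small exceptional sets in an affine parameter space is avoided by a non-zero polynomial

Topic: `Literature/RingTheory/KrullDimension`. The algebraic core of the classical dimension
count behind "the generic member of a linear system avoids …" (Hartshorne, *Algebraic
Geometry*, proof of II Thm. 8.18 (Bertini); de Jong 1996, proof of Lemma 4.13: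
"`dim T ≤ dim Y + dim 𝐏^∨ - n` […] In particular, `pr₁(T) ≠ 𝐏^∨`"), in the following affine
form. Let `k` be an algebraically closed field, `A` a finitely generated `k`-algebra of
dimension `≤ e` (the coordinate ring of an affine chart of the variety along which the
exceptional sets vary), `ι` a finite set of `M` parameters, and `E = V(J) ⊆ Spec A[Tᵢ : i ∈ ι]`
a closed "incidence" subset of `Spec A × 𝔸ᴹ`. Suppose that over every closed point `x` of
`Spec A` the closed points `(x, a)` of `E` lie in a finite union of closed subsets
`V(𝔟) ⊆ 𝔸ᴹ`, each of dimension `≤ M - e - 1`. Then there is a non-zero polynomial `h(T)`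
vanishing at every closed point of `E`, i.e. the image of `E(k)` in `kᴹ` — the set of bad
parameters — lies in the proper closed subset `{h = 0}`
(`exists_ne_zero_forall_mem_of_isMaximal`).

Proof (Matsumura, *Commutative Ring Theory*, Thm. 15.1 (i) and Thm. 5.6): for a minimal prime
`Q` of `J` the affine domain `B = A[T]/Q` has `dim B = height 𝔐` for each maximal `𝔐`, and
`height 𝔐 ≤ height (𝔐 ∩ A) + dim (B/(𝔐 ∩ A)B)_𝔐 ≤ e + (M - e - 1)` (Mathlib
`Ideal.height_le_height_add_of_liesOver`; the fibre ring `B/𝔪B` is a quotient of `k[T]` whose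
spectrum lies in `⋃ V(𝔟)` because its closed points do and `k[T]` is Jacobson); so
`k[T] → B` is not injective (`dim ≥ M` for an injection of affine domains, transcendence degree),
and the product over the finitely many `Q` of non-zero elements of the kernels works.

Also proved here, to feed the hypothesis: for a `k`-linear map `Λ : kᴹ → V` of rank `≥ r + 1`
the ideal `linIdeal Λ ⊆ k[T]` generated by the linear forms `ψ ∘ Λ` (`ψ ∈ V^*`) is contained in
the ideal of every point of `ker Λ` and has `dim k[T]/linIdeal Λ ≤ M - r - 1`
(`ringKrullDim_quotient_linIdeal_add_le`: modulo these forms every variable is a combination of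
`M - rank Λ` of them), and the elementary `krullDim_le_iSup_of_subset_iUnion` (a chain in a union
of upper sets lies in one of them).

## References

* H. Matsumura, *Commutative Ring Theory*, CUP (1986), Thm. 5.6, Thm. 15.1. [Matsumura1987]
* R. Hartshorne, *Algebraic Geometry*, GTM 52 (1977), II Thm. 8.18 (proof). [Hartshorne1977]
* A. J. de Jong, *Smoothness, semi-stability and alterations*, Publ. Math. IHÉS 83 (1996),
  Lemma 4.13 (proof), pp. 69–70. [DeJong1996]
-/

noncomputable section

open Order MvPolynomial

namespace Literature.RingTheory.KrullDimension

universe u v w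

/-! ### Chains in a union of upper sets -/

/-- **A chain in a union of upper sets lies in one of them**: if `S ⊆ ⋃ᵢ Tᵢ` with every `Tᵢ`
an upper set, then `dim S ≤ supᵢ dim Tᵢ` (the bottom of a chain of `S` lies in some `Tᵢ`, and
then so does the whole chain). [folklore] -/
theorem krullDim_le_iSup_of_subset_iUnion {α : Type*} [Preorder α] {S : Set α} {κ : Type*}
    (T : κ → Set α) (hT : ∀ i, IsUpperSet (T i)) (hS : S ⊆ ⋃ i, T i) :
    krullDim S ≤ ⨆ i, krullDim (T i) := by
  change (⨆ (p : LTSeries S), (p.length : WithBot ℕ∞)) ≤ _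
  refine iSup_le fun p => ?_
  obtain ⟨i, hi⟩ := Set.mem_iUnion.mp (hS (p 0).2)
  have hmem : ∀ j, ((p j : S) : α) ∈ T i := fun j =>
    hT i (Subtype.coe_le_coe.mpr (p.strictMono.monotone (Fin.zero_le j))) hi
  let q : LTSeries (T i) := LTSeries.mk p.length (fun j => ⟨p j, hmem j⟩) fun a b hab =>
    p.strictMono hab
  calc (p.length : WithBot ℕ∞) = q.length := rfl
    _ ≤ krullDim (T i) := q.length_le_krullDim
    _ ≤ ⨆ i, krullDim (T i) := le_iSup (fun i => krullDim (T i)) i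

/-- **Dimension of a quotient whose spectrum is covered by finitely many closed sets**: if
every prime containing `I` contains some `𝔟 i`, then `dim R/I ≤ supᵢ dim R/𝔟ᵢ`. [folklore] -/
theorem ringKrullDim_quotient_le_iSup {R : Type*} [CommRing R] (I : Ideal R) {κ : Type*}
    (𝔟 : κ → Ideal R) (h : ∀ P : Ideal R, P.IsPrime → I ≤ P → ∃ i, 𝔟 i ≤ P) :
    ringKrullDim (R ⧸ I) ≤ ⨆ i, ringKrullDim (R ⧸ 𝔟 i) := by
  rw [ringKrullDim_quotient]
  simp_rw [ringKrullDim_quotient]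
  refine krullDim_le_iSup_of_subset_iUnion
    (fun i => PrimeSpectrum.zeroLocus ((𝔟 i : Ideal R) : Set R)) (fun i => ?_) (fun P hP => ?_)
  · intro P P' hPP' hP
    rw [PrimeSpectrum.mem_zeroLocus] at hP ⊢
    exact hP.trans ((PrimeSpectrum.asIdeal_le_asIdeal P P').mpr hPP')
  · rw [PrimeSpectrum.mem_zeroLocus, SetLike.coe_subset_coe] at hP
    obtain ⟨i, hi⟩ := h P.asIdeal P.isPrime hP
    exact Set.mem_iUnion.mpr ⟨i, (PrimeSpectrum.mem_zeroLocus _ _).mpr hi⟩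

/-! ### Linear forms vanishing on the kernel of a linear map -/

section LinForms

variable {k : Type u} [Field k] {ι : Type v} [Fintype ι] [DecidableEq ι]
  {V : Type w} [AddCommGroup V] [Module k V]

/-- The linear form `Σᵢ wᵢ Tᵢ ∈ k[Tᵢ : i ∈ ι]` with coefficient vector `w`. [folklore] -/
def lin : (ι → k) →ₗ[k] MvPolynomial ι k :=
  Fintype.linearCombination k fun i => (X i : MvPolynomial ι k)

omit [DecidableEq ι] in
/-- Unfolding `lin`. [folklore] -/
theorem lin_apply (w : ι → k) : lin w = ∑ i, w i • (X i : MvPolynomial ι k) :=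
  Fintype.linearCombination_apply _ _ _

omit [DecidableEq ι] in
/-- `(Σᵢ wᵢ Tᵢ)(a) = Σᵢ wᵢ aᵢ`. [folklore] -/
theorem eval_lin (a w : ι → k) : eval a (lin w) = ∑ i, w i * a i := by
  simp [lin_apply, smul_eval]

/-- The coordinate form `Tᵢ` is `lin` of the `i`-th standard vector. [folklore] -/
theorem lin_single (i : ι) : lin (Pi.single i 1 : ι → k) = X i := by
  rw [lin_apply, Finset.sum_eq_single i]
  · simp
  · intro j _ hj
    simp [Pi.single_eq_of_ne hj]
  · intro h
    exact absurd (Finset.mem_univ i) h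

omit [Fintype ι] in
/-- The coefficient vector `(ψ(Λ eᵢ))ᵢ` of the linear form `ψ ∘ Λ` on `kᶥ`, for `ψ ∈ V^*`.
[folklore] -/
def dualVec (Λ : (ι → k) →ₗ[k] V) : Module.Dual k V →ₗ[k] (ι → k) :=
  LinearMap.pi fun i => Module.Dual.eval k V (Λ (Pi.single i 1))

omit [Fintype ι] in
/-- Unfolding `dualVec`. [folklore] -/
@[simp]
theorem dualVec_apply (Λ : (ι → k) →ₗ[k] V) (ψ : Module.Dual k V) (i : ι) :
    dualVec Λ ψ i = ψ (Λ (Pi.single i 1)) := rfl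

/-- A vector of `kᶥ` is the combination of the standard vectors with its coordinates. [folklore] -/
theorem sum_smul_single (a : ι → k) : ∑ i, a i • (Pi.single i 1 : ι → k) = a := by
  conv_rhs => rw [← (Pi.basisFun k ι).sum_repr a]
  simp [Pi.basisFun_apply, Pi.basisFun_repr]

/-- `(ψ ∘ Λ)(a) = Σᵢ ψ(Λ eᵢ) aᵢ`. [folklore] -/
theorem sum_dualVec_mul (Λ : (ι → k) →ₗ[k] V) (ψ : Module.Dual k V) (a : ι → k) :
    ∑ i, dualVec Λ ψ i * a i = ψ (Λ a) := by
  conv_rhs => rw [← sum_smul_single a]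
  rw [map_sum, map_sum]
  refine Finset.sum_congr rfl fun i _ => ?_
  rw [map_smul, map_smul, smul_eq_mul, dualVec_apply, mul_comm]

/-- **The ideal of linear forms through `ker Λ`**: the ideal of `k[T]` generated by the linear
forms `ψ ∘ Λ`, `ψ ∈ V^*`. [folklore] -/
def linIdeal (Λ : (ι → k) →ₗ[k] V) : Ideal (MvPolynomial ι k) :=
  Ideal.span (Set.range fun ψ : Module.Dual k V => lin (dualVec Λ ψ))

/-- The forms `ψ ∘ Λ` vanish on `ker Λ`: `linIdeal Λ` lies in the ideal of every point `a` with
`Λ a = 0`. [folklore] -/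
theorem linIdeal_le_ker_eval (Λ : (ι → k) →ₗ[k] V) {a : ι → k} (ha : Λ a = 0) :
    linIdeal Λ ≤ RingHom.ker (eval a) := by
  rw [linIdeal, Ideal.span_le]
  rintro _ ⟨ψ, rfl⟩
  rw [SetLike.mem_coe, RingHom.mem_ker, eval_lin, sum_dualVec_mul, ha, map_zero]

/-- `lin` maps the range of `dualVec Λ` into `linIdeal Λ`. [folklore] -/
theorem lin_mem_linIdeal (Λ : (ι → k) →ₗ[k] V) {w : ι → k}
    (hw : w ∈ LinearMap.range (dualVec Λ)) : lin w ∈ linIdeal Λ := by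
  obtain ⟨ψ, rfl⟩ := hw
  exact Ideal.subset_span ⟨ψ, rfl⟩

/-- The range of `dualVec Λ` has the dimension of the range of `Λ` (it is the range of the dual
map of `Λ`, read in the coordinates dual to the standard basis). [folklore] -/
theorem finrank_range_dualVec (Λ : (ι → k) →ₗ[k] V) :
    Module.finrank k (LinearMap.range (dualVec Λ)) = Module.finrank k (LinearMap.range Λ) := by
  let e : Module.Dual k (ι → k) ≃ₗ[k] (ι → k) :=
    (Pi.basisFun k ι).dualBasis.repr.trans (Finsupp.linearEquivFunOnFinite k k ι)
  have he : dualVec Λ = e.toLinearMap ∘ₗ Λ.dualMap := by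
    ext ψ i
    simp [e, Module.Basis.dualBasis_repr, Pi.basisFun_apply, LinearMap.dualMap_apply]
  rw [he, LinearMap.range_comp, LinearEquiv.finrank_map_eq,
    LinearMap.finrank_range_dualMap_eq_finrank_range]

/-- **Modulo the forms through `ker Λ`, the polynomial ring is generated by `M - rank Λ`
variables**, so `dim k[T]/linIdeal Λ + (r + 1) ≤ M` whenever `rank Λ ≥ r + 1`. [folklore] -/
theorem ringKrullDim_quotient_linIdeal_add_le (Λ : (ι → k) →ₗ[k] V) {r : ℕ}
    (hr : r + 1 ≤ Module.finrank k (LinearMap.range Λ)) :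
    ringKrullDim (MvPolynomial ι k ⧸ linIdeal Λ) + (r + 1 : ℕ) ≤ Fintype.card ι := by
  classical
  set U : Submodule k (ι → k) := LinearMap.range (dualVec Λ) with hU
  -- a linearly independent spanning subset `b` of the images of the standard vectors in `kᶥ/U`
  set t : Set ((ι → k) ⧸ U) := Set.range fun i => U.mkQ (Pi.single i 1) with ht
  obtain ⟨b, hbt, hbspan, hbli⟩ := exists_linearIndependent k t
  have hbfin : b.Finite := (Set.finite_range _).subset hbt
  letI : Fintype b := hbfin.fintype
  -- `span b = ⊤`
  have h1 : Submodule.span k (Set.range fun i => (Pi.single i 1 : ι → k)) = ⊤ := by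
    have h := (Pi.basisFun k ι).span_eq
    have hr : Set.range (Pi.basisFun k ι) = Set.range fun i => (Pi.single i 1 : ι → k) :=
      congrArg Set.range (funext fun i => Pi.basisFun_apply k ι i)
    rwa [hr] at h
  have htspan : Submodule.span k t = ⊤ := by
    rw [ht]
    change Submodule.span k (Set.range (U.mkQ ∘ fun i => (Pi.single i 1 : ι → k))) = ⊤
    rw [Set.range_comp, Submodule.span_image, h1, Submodule.map_top,
      LinearMap.range_eq_top.mpr U.mkQ_surjective]
  rw [htspan] at hbspan
  -- `#b = dim kᶥ/U = M - rank Λ`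
  have hcard : Fintype.card b + Module.finrank k U = Fintype.card ι := by
    have h2 : Module.finrank k (Submodule.span k b) = Fintype.card b := by
      rw [finrank_span_set_eq_card (R := k) (s := b) hbli, Set.toFinset_card]
    rw [hbspan, finrank_top] at h2
    rw [← h2, Submodule.finrank_quotient_add_finrank, Module.finrank_fintype_fun_eq_card]
  have hUr : r + 1 ≤ Module.finrank k U := by rwa [hU, finrank_range_dualVec]
  -- indices of preimages
  have hidx : ∀ x : b, ∃ i : ι, U.mkQ (Pi.single i 1) = x := fun x => by
    obtain ⟨i, hi⟩ := hbt x.2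
    exact ⟨i, hi⟩
  choose idx hidx using hidx
  -- the substitution map `k[X_b] → k[T]/linIdeal Λ`
  let θ : MvPolynomial b k →ₐ[k] (MvPolynomial ι k ⧸ linIdeal Λ) :=
    aeval fun x : b => Ideal.Quotient.mk (linIdeal Λ) (X (idx x))
  have hC : ∀ c : k, Ideal.Quotient.mk (linIdeal Λ) (C c) ∈ θ.range := fun c => by
    have : Ideal.Quotient.mk (linIdeal Λ) (C c) = algebraMap k _ c := rfl
    rw [this]
    exact Subalgebra.algebraMap_mem _ c
  have hXb : ∀ x : b, Ideal.Quotient.mk (linIdeal Λ) (X (idx x)) ∈ θ.range := fun x =>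
    ⟨X x, by simp [θ]⟩
  have hX : ∀ j : ι, Ideal.Quotient.mk (linIdeal Λ) (X j) ∈ θ.range := by
    intro j
    have hj : U.mkQ (Pi.single j 1) ∈
        Submodule.span k (Set.range fun x : b => (x : (ι → k) ⧸ U)) := by
      rw [Subtype.range_coe, hbspan]; trivial
    obtain ⟨c, hc⟩ := (Submodule.mem_span_range_iff_exists_fun k).mp hj
    -- the vector `e_j - Σ c_x e_{idx x}` lies in `U`
    have hmem : (Pi.single j 1 : ι → k) - ∑ x : b, c x • (Pi.single (idx x) 1 : ι → k) ∈ U := by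
      rw [← Submodule.Quotient.mk_eq_zero, ← Submodule.mkQ_apply, map_sub, map_sum, sub_eq_zero,
        ← hc]
      refine Finset.sum_congr rfl fun x _ => ?_
      rw [map_smul, hidx x]
    have hlin := lin_mem_linIdeal Λ hmem
    rw [map_sub, map_sum, lin_single] at hlin
    have heq : Ideal.Quotient.mk (linIdeal Λ) (X j) =
        Ideal.Quotient.mk (linIdeal Λ) (∑ x : b, lin (c x • (Pi.single (idx x) 1 : ι → k))) := by
      rw [Ideal.Quotient.eq]
      exact hlin
    rw [heq, map_sum]
    refine Subalgebra.sum_mem _ fun x _ => ?_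
    rw [map_smul, lin_single, MvPolynomial.smul_eq_C_mul, map_mul]
    exact Subalgebra.mul_mem _ (hC _) (hXb x)
  have hall : ∀ p : MvPolynomial ι k, Ideal.Quotient.mk (linIdeal Λ) p ∈ θ.range := by
    intro p
    induction p using MvPolynomial.induction_on with
    | C c => exact hC c
    | add p q hp hq => rw [map_add]; exact Subalgebra.add_mem _ hp hq
    | mul_X p j hp => rw [map_mul]; exact Subalgebra.mul_mem _ hp (hX j)
  have hθ : Function.Surjective θ := fun q => by
    obtain ⟨p, rfl⟩ := Ideal.Quotient.mk_surjective q
    exact hall p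
  -- dimensions
  have hdim : ringKrullDim (MvPolynomial ι k ⧸ linIdeal Λ) ≤ Fintype.card b := by
    refine (ringKrullDim_le_of_surjective θ.toRingHom hθ).trans (le_of_eq ?_)
    rw [MvPolynomial.ringKrullDim_of_isNoetherianRing, ringKrullDim_eq_zero_of_field k, zero_add,
      Nat.card_eq_fintype_card]
  have hnat : Fintype.card b + (r + 1) ≤ Fintype.card ι := by omega
  calc ringKrullDim (MvPolynomial ι k ⧸ linIdeal Λ) + (r + 1 : ℕ)
      ≤ (Fintype.card b : WithBot ℕ∞) + (r + 1 : ℕ) := add_le_add hdim le_rfl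
    _ ≤ Fintype.card ι := by exact_mod_cast hnat

end LinForms

/-! ### Closed points of finitely generated algebras over an algebraically closed field -/

section Points

variable (k : Type u) [Field k] [IsAlgClosed k] {A : Type v} [CommRing A] [Algebra k A]
  [Algebra.FiniteType k A]

include k in
/-- **Weak Nullstellensatz**: the residue field of a maximal ideal of a finitely generated
algebra over an algebraically closed field `k` is `k`. [folklore] -/
theorem algebraMap_quotient_surjective_of_isMaximal (𝔪 : Ideal A) [𝔪.IsMaximal] :
    Function.Surjective (algebraMap k (A ⧸ 𝔪)) := by
  letI := Ideal.Quotient.field 𝔪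
  haveI : IsJacobsonRing k := inferInstance
  haveI : Algebra.FiniteType k (A ⧸ 𝔪) :=
    Algebra.FiniteType.of_surjective (Ideal.Quotient.mkₐ k 𝔪) Ideal.Quotient.mk_surjective
  haveI : Module.Finite k (A ⧸ 𝔪) := finite_of_finite_type_of_isJacobsonRing k (A ⧸ 𝔪)
  haveI : Algebra.IsIntegral k (A ⧸ 𝔪) := Algebra.IsIntegral.of_finite k (A ⧸ 𝔪)
  exact (IsAlgClosed.algebraMap_bijective_of_isIntegral (k := k) (K := A ⧸ 𝔪)).2

include k in
/-- Every element of `A` is congruent to a constant modulo a maximal ideal. [folklore] -/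
theorem exists_sub_algebraMap_mem_of_isMaximal (𝔪 : Ideal A) [𝔪.IsMaximal] (a : A) :
    ∃ c : k, a - algebraMap k A c ∈ 𝔪 := by
  obtain ⟨c, hc⟩ := algebraMap_quotient_surjective_of_isMaximal k 𝔪 (Ideal.Quotient.mk 𝔪 a)
  refine ⟨c, ?_⟩
  rw [← Ideal.Quotient.eq, ← hc]
  rfl

omit [IsAlgClosed k] in
include k in
/-- The contraction to `A` of a maximal ideal of `A[T]` is maximal (`A` is Jacobson).
[folklore] -/
theorem isMaximal_comap_C_of_isMaximal {ι : Type w} [Finite ι] (𝔐 : Ideal (MvPolynomial ι A))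
    [𝔐.IsMaximal] : (𝔐.comap (C : A →+* MvPolynomial ι A)).IsMaximal := by
  letI := Ideal.Quotient.field 𝔐
  haveI : IsJacobsonRing A := isJacobsonRing_of_finiteType (A := k) (B := A)
  have hint : ((Ideal.Quotient.mk 𝔐).comp C).IsIntegral :=
    MvPolynomial.comp_C_integral_of_surjective_of_isJacobsonRing _ Ideal.Quotient.mk_surjective
  have h := Ideal.isMaximal_comap_of_isIntegral_of_isMaximal' _ hint ⊥
  rwa [← RingHom.ker_eq_comap_bot, ← RingHom.comap_ker, Ideal.mk_ker] at h

end Points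

/-! ### Generic avoidance -/

section Avoidance

variable (k : Type u) [Field k] [IsAlgClosed k] {A : Type v} [CommRing A] [Algebra k A]
  [Algebra.FiniteType k A] {ι : Type w} [Finite ι]

/-- The arithmetic of the dimension count: `M ≤ H ≤ Hₘ + H'`, `Hₘ ≤ e` and `H' + e + 1 ≤ M`
are incompatible. [folklore] -/
theorem false_of_dimension_count {H H' Hm : ℕ∞} {M e : ℕ} (hM : (M : ℕ∞) ≤ H)
    (h15 : H ≤ Hm + H') (hme : Hm ≤ e)
    (h6 : ((H' : ℕ∞) : WithBot ℕ∞) + ((e + 1 : ℕ) : WithBot ℕ∞) ≤ ((M : ℕ) : WithBot ℕ∞)) :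
    False := by
  have h7 : H' + ((e + 1 : ℕ) : ℕ∞) ≤ (M : ℕ∞) := by
    rw [← WithBot.coe_le_coe, WithBot.coe_add]
    simpa using h6
  have hfin : H' ≠ ⊤ := by
    intro htop
    rw [htop, top_add] at h7
    exact ENat.coe_ne_top _ (top_le_iff.mp h7)
  obtain ⟨m, rfl⟩ := ENat.ne_top_iff_exists.mp hfin
  have h9 : (M : ℕ∞) ≤ (e : ℕ∞) + m := hM.trans (h15.trans (add_le_add hme le_rfl))
  have h11 : M ≤ e + m := by exact_mod_cast h9
  have h12 : m + (e + 1) ≤ M := by exact_mod_cast h7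
  omega

include k in
/-- The core of generic avoidance, for one irreducible component `V(Q)` of the incidence set:
under the fibre hypothesis, `k[T] → A[T]/Q` is not injective. See
`exists_ne_zero_forall_mem_of_isMaximal`. [cite: Matsumura1987, Thm. 15.1 (i) and Thm. 5.6] -/
theorem exists_ne_zero_map_mem_of_isPrime (e : ℕ) (hA : ringKrullDim A ≤ e)
    (J : Ideal (MvPolynomial ι A))
    (hfib : ∀ 𝔪 : Ideal A, 𝔪.IsMaximal →
      ∃ s : Finset (Ideal (MvPolynomial ι k)),
        (∀ 𝔟 ∈ s, ringKrullDim (MvPolynomial ι k ⧸ 𝔟) + (e + 1 : ℕ) ≤ Nat.card ι) ∧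
        ∀ 𝔐 : Ideal (MvPolynomial ι A), 𝔐.IsMaximal → J ≤ 𝔐 →
          𝔐.comap (C : A →+* MvPolynomial ι A) = 𝔪 →
            ∃ 𝔟 ∈ s, 𝔟.map (MvPolynomial.map (algebraMap k A)) ≤ 𝔐)
    (Q : Ideal (MvPolynomial ι A)) [Q.IsPrime] (hJQ : J ≤ Q) :
    ∃ h : MvPolynomial ι k, h ≠ 0 ∧ MvPolynomial.map (algebraMap k A) h ∈ Q := by
  classical
  haveI : IsNoetherianRing A := Algebra.FiniteType.isNoetherianRing k A
  haveI : IsNoetherianRing (MvPolynomial ι A) := MvPolynomial.isNoetherianRing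
  haveI hft : Algebra.FiniteType k (MvPolynomial ι A) :=
    (inferInstance : Algebra.FiniteType k A).trans inferInstance
  -- the affine domain `B = A[T]/Q`
  haveI : IsDomain (MvPolynomial ι A ⧸ Q) := Ideal.Quotient.isDomain Q
  haveI : Algebra.FiniteType k (MvPolynomial ι A ⧸ Q) :=
    hft.of_surjective (Ideal.Quotient.mkₐ k Q) Ideal.Quotient.mk_surjective
  by_contra hcon
  push Not at hcon
  -- `k[T] → B` is injective, so `M ≤ dim B`
  let φ : MvPolynomial ι k →ₐ[k] MvPolynomial ι A ⧸ Q :=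
    (Ideal.Quotient.mkₐ k Q).comp (MvPolynomial.mapAlgHom (Algebra.ofId k A))
  have hφ : ∀ p, φ p = Ideal.Quotient.mk Q (MvPolynomial.map (algebraMap k A) p) := fun p => rfl
  have hinj : Function.Injective φ := by
    rw [injective_iff_map_eq_zero]
    intro p hp
    rw [hφ, Ideal.Quotient.eq_zero_iff_mem] at hp
    by_contra h0
    exact hcon p h0 hp
  have hM : ((Nat.card ι : ℕ) : WithBot ℕ∞) ≤ ringKrullDim (MvPolynomial ι A ⧸ Q) := by
    have h := ringKrullDim_le_of_injective k φ hinj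
    rwa [MvPolynomial.ringKrullDim_of_isNoetherianRing, ringKrullDim_eq_zero_of_field k,
      zero_add] at h
  -- a maximal ideal `𝔐'` of `B`; `dim B = height 𝔐'`
  obtain ⟨𝔐', h𝔐'⟩ := Ideal.exists_maximal (MvPolynomial ι A ⧸ Q)
  have hdimB : ringKrullDim (MvPolynomial ι A ⧸ Q) = 𝔐'.height := by
    have h := ringKrullDim_quotient_add_height k 𝔐'
    have hF : ringKrullDim ((MvPolynomial ι A ⧸ Q) ⧸ 𝔐') = 0 := by
      letI := Ideal.Quotient.field 𝔐'
      convert ringKrullDim_eq_zero_of_field ((MvPolynomial ι A ⧸ Q) ⧸ 𝔐')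
    rw [hF, zero_add] at h
    exact h.symm
  -- its contractions `𝔐 ⊆ A[T]` and `𝔪 ⊆ A`
  set 𝔐 : Ideal (MvPolynomial ι A) := 𝔐'.comap (Ideal.Quotient.mk Q) with h𝔐def
  haveI h𝔐max : 𝔐.IsMaximal := Ideal.comap_isMaximal_of_surjective _ Ideal.Quotient.mk_surjective
  set 𝔪 : Ideal A := 𝔐.comap (C : A →+* MvPolynomial ι A) with h𝔪def
  haveI h𝔪max : 𝔪.IsMaximal := isMaximal_comap_C_of_isMaximal k 𝔐
  obtain ⟨s, hsdim, hs⟩ := hfib 𝔪 h𝔪max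
  -- Matsumura 15.1 (i): `height 𝔐' ≤ height 𝔪 + height (𝔐' mod 𝔪B)`
  haveI h𝔐'over : 𝔐'.LiesOver 𝔪 := ⟨by
    rw [Ideal.under_def, ← Ideal.Quotient.mk_comp_algebraMap, MvPolynomial.algebraMap_eq,
      ← Ideal.comap_comap]⟩
  have h15 := Ideal.height_le_height_add_of_liesOver 𝔪 𝔐'
  set I𝔪 := 𝔪.map (algebraMap A (MvPolynomial ι A ⧸ Q)) with hI𝔪
  set 𝔐bar := 𝔐'.map (Ideal.Quotient.mk I𝔪) with h𝔐bar
  have h𝔪e : 𝔪.height ≤ e := by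
    have h := (Ideal.height_le_ringKrullDim_of_ne_top h𝔪max.ne_top).trans hA
    exact_mod_cast h
  -- `𝔐bar` is maximal
  have hI𝔐' : I𝔪 ≤ 𝔐' := by
    rw [hI𝔪, Ideal.map_le_iff_le_comap, ← Ideal.under_def, ← h𝔐'over.over]
  have h𝔐barmax : 𝔐bar.IsMaximal := by
    refine (Ideal.map_eq_top_or_isMaximal_of_surjective _ Ideal.Quotient.mk_surjective
      h𝔐').resolve_left fun htop => h𝔐'.ne_top ?_
    have h := Ideal.comap_map_of_surjective (Ideal.Quotient.mk I𝔪) Ideal.Quotient.mk_surjective 𝔐'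
    rw [← RingHom.ker_eq_comap_bot, Ideal.mk_ker, sup_eq_left.mpr hI𝔐'] at h
    rw [← h, htop, Ideal.comap_top]
  -- the fibre ring `B̄ = B/𝔪B` is a quotient of `k[T]`
  let ψ : MvPolynomial ι k →+* (MvPolynomial ι A ⧸ Q) ⧸ I𝔪 :=
    (Ideal.Quotient.mk I𝔪).comp ((Ideal.Quotient.mk Q).comp (MvPolynomial.map (algebraMap k A)))
  have hψ : ∀ p, ψ p =
      Ideal.Quotient.mk I𝔪 (Ideal.Quotient.mk Q (MvPolynomial.map (algebraMap k A) p)) :=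
    fun p => rfl
  have hCmem : ∀ a : A, a ∈ 𝔪 → Ideal.Quotient.mk Q (C a) ∈ I𝔪 := fun a ha => by
    rw [hI𝔪]
    exact Ideal.mem_map_of_mem (algebraMap A (MvPolynomial ι A ⧸ Q)) ha
  have hψC : ∀ a : A, Ideal.Quotient.mk I𝔪 (Ideal.Quotient.mk Q (C a)) ∈ ψ.range := by
    intro a
    obtain ⟨c, hc⟩ := exists_sub_algebraMap_mem_of_isMaximal k 𝔪 a
    refine ⟨C c, ?_⟩
    rw [hψ, MvPolynomial.map_C, eq_comm, ← sub_eq_zero, ← map_sub, ← map_sub, ← map_sub,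
      Ideal.Quotient.eq_zero_iff_mem]
    exact hCmem _ hc
  have hψsurj : Function.Surjective ψ := by
    have hall : ∀ p : MvPolynomial ι A,
        Ideal.Quotient.mk I𝔪 (Ideal.Quotient.mk Q p) ∈ ψ.range := by
      intro p
      induction p using MvPolynomial.induction_on with
      | C a => exact hψC a
      | add p q hp hq => rw [map_add, map_add]; exact Subring.add_mem _ hp hq
      | mul_X p j hp =>
        rw [map_mul, map_mul]
        refine Subring.mul_mem _ hp ⟨X j, ?_⟩
        rw [hψ, MvPolynomial.map_X]
    intro x
    obtain ⟨y, rfl⟩ := Ideal.Quotient.mk_surjective x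
    obtain ⟨p, rfl⟩ := Ideal.Quotient.mk_surjective y
    exact hall p
  -- Claim: every prime of `k[T]` over `ker ψ` contains some `𝔟 ∈ s` (closed points + Jacobson)
  have hmax : ∀ 𝔫 : Ideal (MvPolynomial ι k), 𝔫.IsMaximal → RingHom.ker ψ ≤ 𝔫 →
      ∃ 𝔟 ∈ s, 𝔟 ≤ 𝔫 := by
    intro 𝔫 h𝔫 hker
    have hcomap : (𝔫.map ψ).comap ψ = 𝔫 := by
      rw [Ideal.comap_map_of_surjective ψ hψsurj, ← RingHom.ker_eq_comap_bot,
        sup_eq_left.mpr hker]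
    haveI h𝔑 : (𝔫.map ψ).IsMaximal := by
      refine (Ideal.map_eq_top_or_isMaximal_of_surjective ψ hψsurj h𝔫).resolve_left
        fun htop => h𝔫.ne_top ?_
      rw [← hcomap, htop, Ideal.comap_top]
    -- pull back to a closed point of `V(J)` over `𝔪`
    set 𝔐₁ : Ideal (MvPolynomial ι A) :=
      ((𝔫.map ψ).comap (Ideal.Quotient.mk I𝔪)).comap (Ideal.Quotient.mk Q) with h𝔐₁
    haveI h𝔐₁max : 𝔐₁.IsMaximal := by
      have hsurj2 : Function.Surjective ((Ideal.Quotient.mk I𝔪).comp (Ideal.Quotient.mk Q)) :=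
        Ideal.Quotient.mk_surjective.comp Ideal.Quotient.mk_surjective
      rw [h𝔐₁, Ideal.comap_comap]
      exact Ideal.comap_isMaximal_of_surjective _ hsurj2
    have hJ𝔐₁ : J ≤ 𝔐₁ := hJQ.trans fun x hx => by
      simp [h𝔐₁, Ideal.mem_comap, Ideal.Quotient.eq_zero_iff_mem.mpr hx]
    have h𝔐₁𝔪 : 𝔐₁.comap (C : A →+* MvPolynomial ι A) = 𝔪 := by
      refine (h𝔪max.eq_of_le (Ideal.comap_ne_top _ h𝔐₁max.ne_top) fun a ha => ?_).symm
      simp [h𝔐₁, Ideal.mem_comap, Ideal.Quotient.eq_zero_iff_mem.mpr (hCmem a ha)]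
    obtain ⟨𝔟, h𝔟s, h𝔟⟩ := hs 𝔐₁ h𝔐₁max hJ𝔐₁ h𝔐₁𝔪
    refine ⟨𝔟, h𝔟s, ?_⟩
    have hψcomap : (𝔫.map ψ).comap ψ = 𝔐₁.comap (MvPolynomial.map (algebraMap k A)) := by
      change Ideal.comap ((Ideal.Quotient.mk I𝔪).comp ((Ideal.Quotient.mk Q).comp
        (MvPolynomial.map (algebraMap k A)))) _ = _
      rw [← Ideal.comap_comap, ← Ideal.comap_comap]
    rw [← hcomap, hψcomap, ← Ideal.map_le_iff_le_comap]
    exact h𝔟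
  have hcover : ∀ P : Ideal (MvPolynomial ι k), P.IsPrime → RingHom.ker ψ ≤ P →
      ∃ 𝔟 ∈ s, 𝔟 ≤ P := by
    intro P hP hker
    by_contra hne
    push Not at hne
    have hprod : ¬ s.prod id ≤ P := by
      rw [hP.prod_le]
      rintro ⟨𝔟, h𝔟s, h𝔟P⟩
      exact hne 𝔟 h𝔟s h𝔟P
    obtain ⟨x, hx, hxP⟩ := Set.not_subset.mp hprod
    rw [SetLike.mem_coe] at hx hxP
    have hjac : P.jacobson = P := IsJacobsonRing.out inferInstance hP.isRadical
    rw [← hjac, Ideal.jacobson, Submodule.mem_sInf] at hxP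
    push Not at hxP
    obtain ⟨𝔫, ⟨hP𝔫, h𝔫⟩, hx𝔫⟩ := hxP
    obtain ⟨𝔟, h𝔟s, h𝔟𝔫⟩ := hmax 𝔫 h𝔫 (hker.trans hP𝔫)
    exact hx𝔫 (h𝔟𝔫 ((Ideal.prod_le_inf.trans (Finset.inf_le h𝔟s)) hx))
  -- `s` is nonempty and `dim B̄ ≤ dim k[T]/𝔟₀` for the worst `𝔟₀ ∈ s`
  have hsne : s.Nonempty := by
    obtain ⟨𝔟, h𝔟s, -⟩ := hcover (𝔐bar.comap ψ) (Ideal.comap_isPrime ψ 𝔐bar)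
      (fun x hx => by
        rw [Ideal.mem_comap, (RingHom.mem_ker).mp hx]
        exact zero_mem _)
    exact ⟨𝔟, h𝔟s⟩
  have h4 : ringKrullDim (MvPolynomial ι k ⧸ RingHom.ker ψ) ≤
      ⨆ 𝔟 : s, ringKrullDim (MvPolynomial ι k ⧸ (𝔟 : Ideal (MvPolynomial ι k))) := by
    refine ringKrullDim_quotient_le_iSup (RingHom.ker ψ)
      (fun 𝔟 : s => (𝔟 : Ideal (MvPolynomial ι k))) fun P hP hle => ?_
    obtain ⟨𝔟, h𝔟s, h𝔟P⟩ := hcover P hP hle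
    exact ⟨⟨𝔟, h𝔟s⟩, h𝔟P⟩
  obtain ⟨𝔟₀, h𝔟₀s, hmax𝔟⟩ :=
    Finset.exists_max_image s (fun 𝔟 => ringKrullDim (MvPolynomial ι k ⧸ 𝔟)) hsne
  have h4' : ringKrullDim (MvPolynomial ι k ⧸ RingHom.ker ψ) ≤
      ringKrullDim (MvPolynomial ι k ⧸ 𝔟₀) :=
    h4.trans (iSup_le fun 𝔟 => hmax𝔟 𝔟 𝔟.2)
  -- the count
  have h3 := Ideal.height_le_ringKrullDim_of_ne_top (R := (MvPolynomial ι A ⧸ Q) ⧸ I𝔪)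
    h𝔐barmax.ne_top
  have hequiv := ringKrullDim_eq_of_ringEquiv (S := (MvPolynomial ι A ⧸ Q) ⧸ I𝔪)
    (RingHom.quotientKerEquivOfSurjective hψsurj)
  rw [← hequiv] at h3
  replace h3 := h3.trans h4'
  have h5 := hsdim 𝔟₀ h𝔟₀s
  have h6 := (add_le_add h3 (le_refl (((e + 1 : ℕ) : ℕ) : WithBot ℕ∞))).trans h5
  have h8 : ((Nat.card ι : ℕ) : ℕ∞) ≤ 𝔐'.height := by
    have h := hM
    rw [hdimB] at h
    exact_mod_cast h
  exact false_of_dimension_count h8 h15 h𝔪e h6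

include k in
/-- **Generic avoidance.** Let `k` be algebraically closed, `A` a finitely generated `k`-algebra
with `dim A ≤ e`, `ι` a finite set of parameters `T`, and `J ⊆ A[T]` (the ideal of a closed
incidence set `E ⊆ Spec A × 𝔸^ι`). Suppose that for every closed point `𝔪` of `Spec A` there
are finitely many ideals `𝔟 ⊆ k[T]`, each with `dim k[T]/𝔟 + e + 1 ≤ #ι`, such that every
closed point `𝔐 ⊇ J` of `Spec A[T]` over `𝔪` contains (the extension of) one of them — "the
bad parameters over each point of the `e`-dimensional `Spec A` form a set of codimension
`≥ e + 1`". Then some non-zero `h ∈ k[T]` lies in every closed point of `V(J)`: the bad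
parameters all satisfy `h = 0` (Hartshorne II 8.18, proof; de Jong 1996, proof of 4.13, the
dimension count for `T ⊆ 𝐏^∨ × Y`). [cite: Matsumura1987, Thm. 15.1 (i) and Thm. 5.6] -/
theorem exists_ne_zero_forall_mem_of_isMaximal (e : ℕ) (hA : ringKrullDim A ≤ e)
    (J : Ideal (MvPolynomial ι A))
    (hfib : ∀ 𝔪 : Ideal A, 𝔪.IsMaximal →
      ∃ s : Finset (Ideal (MvPolynomial ι k)),
        (∀ 𝔟 ∈ s, ringKrullDim (MvPolynomial ι k ⧸ 𝔟) + (e + 1 : ℕ) ≤ Nat.card ι) ∧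
        ∀ 𝔐 : Ideal (MvPolynomial ι A), 𝔐.IsMaximal → J ≤ 𝔐 →
          𝔐.comap (C : A →+* MvPolynomial ι A) = 𝔪 →
            ∃ 𝔟 ∈ s, 𝔟.map (MvPolynomial.map (algebraMap k A)) ≤ 𝔐) :
    ∃ h : MvPolynomial ι k, h ≠ 0 ∧
      ∀ 𝔐 : Ideal (MvPolynomial ι A), 𝔐.IsMaximal → J ≤ 𝔐 →
        MvPolynomial.map (algebraMap k A) h ∈ 𝔐 := by
  classical
  haveI : IsNoetherianRing A := Algebra.FiniteType.isNoetherianRing k A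
  haveI : IsNoetherianRing (MvPolynomial ι A) := MvPolynomial.isNoetherianRing
  have hfin := J.finite_minimalPrimes_of_isNoetherianRing
  -- one non-zero polynomial per minimal prime of `J`
  have key : ∀ Q : hfin.toFinset, ∃ h : MvPolynomial ι k, h ≠ 0 ∧
      MvPolynomial.map (algebraMap k A) h ∈ (Q : Ideal (MvPolynomial ι A)) := fun Q => by
    have hQ : (Q : Ideal (MvPolynomial ι A)) ∈ J.minimalPrimes := hfin.mem_toFinset.mp Q.2
    haveI : (Q : Ideal (MvPolynomial ι A)).IsPrime := hQ.1.1
    exact exists_ne_zero_map_mem_of_isPrime k e hA J hfib Q hQ.1.2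
  choose h hh0 hhQ using key
  refine ⟨∏ Q, h Q, Finset.prod_ne_zero_iff.mpr fun Q _ => hh0 Q, fun 𝔐 h𝔐 hJ𝔐 => ?_⟩
  obtain ⟨Q, hQ, hQ𝔐⟩ := Ideal.exists_minimalPrimes_le (J := 𝔐) hJ𝔐
  have hmem : MvPolynomial.map (algebraMap k A) (h ⟨Q, hfin.mem_toFinset.mpr hQ⟩) ∈ 𝔐 :=
    hQ𝔐 (hhQ ⟨Q, hfin.mem_toFinset.mpr hQ⟩)
  rw [map_prod, ← Finset.prod_erase_mul _ _ (Finset.mem_univ ⟨Q, hfin.mem_toFinset.mpr hQ⟩)]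
  exact 𝔐.mul_mem_left _ hmem

end Avoidance

end Literature.RingTheory.KrullDimension
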